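import Summits.Ventures.PercRepro.GenQFlatLatticeK

/-!
# PercRepro — the flat-lattice counting rows, part M: the coloop-free spanning subsets of a pencil's traces (GS0c)
(night-4, gen 12)

In a pencil (`3s − 2n > B`, `h_s ≥ 2`; part J) every `s`-trace `H ∩ G` contains the common rank-`(q − 2)` flat `F`,
and `h_s·(s − f) ≤ n − f` for `f = |F ∩ G|` (part K).  A spanning COLOOP-FREE `j`-subset `T` of the trace (rank
`q − 1`, `m(T) = 0`) is not inside `F` (rank `q − 2`), and cannot meet `H ∖ F` in a single point `x` either — then
`T ∖ x ⊆ F` would have rank `≤ q − 2`, making `x` a coloop of `T`.  So `T` has `≥ 2` points outside `F`, and for any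
`F₀ ⊆ F ∩ G` with `f₀` points the `j`-subsets of the trace with `≥ 2` points outside `F₀` number at most

`A₂(s, f₀, j) = Σ_{i ≥ 2} C(s − f₀, i)·C(f₀, j − i)` (written out as the sum; no new definition).

Summed over the `h_s` traces: `SPm(s, j, 0) ≤ h_s·A₂(s, f₀, j)` for every `f₀ ≤ f` (`gs0c_row`) — the row (GS0c)
of the two-level profile LP in the class `h_s = hv` (sheet §65 (b); the class `(h₁₅, h₁₄) = (3, 0)` of type `6`,
`d = 10` of the `(9, 7)` residue is closed by this row alone on the tree-theorem rows: mining/night-4/g12/audit4/).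
Imports `GenQFlatLatticeK`.
-/
namespace PercRepro.Night4

open Finset ThmH SixFour GenQ PerFlat Star

variable {α : Type*} [DecidableEq α] {M : Matroid α} [M.Finite]

/-- The `j`-subsets `T` of `S` with exactly `i` points outside `F₀` number at most `C(|S ∖ F₀|, i)·C(|F₀|, j − i)`
(the injection `T ↦ (T ∖ F₀, T ∩ F₀)`; `F₀ ⊆ S` is not needed for the bound). -/
theorem card_filter_sdiff_eq_le (S F₀ : Finset α) (j i : ℕ) :
    ((S.powersetCard j).filter (fun T : Finset α => (T \ F₀).card = i)).card ≤
      (S \ F₀).card.choose i * F₀.card.choose (j - i) := by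
  classical
  rw [← Finset.card_powersetCard, ← Finset.card_powersetCard, ← Finset.card_product]
  apply Finset.card_le_card_of_injOn (fun T => (T \ F₀, T ∩ F₀))
  · intro T hT
    rw [Finset.mem_coe, Finset.mem_filter, Finset.mem_powersetCard] at hT
    obtain ⟨⟨hTS, hTj⟩, hi⟩ := hT
    rw [Finset.mem_coe, Finset.mem_product, Finset.mem_powersetCard, Finset.mem_powersetCard]
    refine ⟨⟨Finset.sdiff_subset_sdiff hTS (Finset.Subset.refl F₀), hi⟩, Finset.inter_subset_right, ?_⟩
    show (T ∩ F₀).card = j - i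
    have := Finset.card_sdiff_add_card_inter T F₀
    omega
  · intro T₁ _ T₂ _ heq
    simp only [Prod.mk.injEq] at heq
    rw [← Finset.sdiff_union_inter T₁ F₀, ← Finset.sdiff_union_inter T₂ F₀, heq.1, heq.2]

/-- The `j`-subsets `T` of `S` with `≥ 2` points outside `F₀ ⊆ S` number at most `A₂(|S|, |F₀|, j) = Σ_{i ∈ [2, j]} C(|S| − |F₀|, i)·C(|F₀|, j − i)`. -/
theorem card_filter_two_le_sdiff_le {S F₀ : Finset α} (hF₀ : F₀ ⊆ S) (j : ℕ) :
    ((S.powersetCard j).filter (fun T : Finset α => 2 ≤ (T \ F₀).card)).card ≤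
      ∑ i ∈ Finset.Icc 2 j, (S.card - F₀.card).choose i * F₀.card.choose (j - i) := by
  classical
  rw [← Finset.card_sdiff_of_subset hF₀]
  rw [Finset.card_eq_sum_card_fiberwise (s := (S.powersetCard j).filter (fun T : Finset α => 2 ≤ (T \ F₀).card))
    (t := Finset.Icc 2 j) (f := fun T => (T \ F₀).card) (fun T hT => by
      rw [Finset.mem_coe, Finset.mem_filter, Finset.mem_powersetCard] at hT
      exact Finset.mem_coe.2 (Finset.mem_Icc.2 ⟨hT.2, hT.1.2 ▸ Finset.card_le_card Finset.sdiff_subset⟩))]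
  apply Finset.sum_le_sum
  intro i _
  refine le_trans (Finset.card_le_card ?_) (card_filter_sdiff_eq_le S F₀ j i)
  intro T hT
  rw [Finset.mem_filter] at hT ⊢
  exact ⟨(Finset.mem_filter.1 hT.1).1, hT.2⟩

/-- A coloop-free subset `T` of `G` of rank `q − 1` has at least two points outside any rank-`(q − 2)` flat `F`
(`3 ≤ q`): `T ⊄ F` by rank, and a single point `x` of `T` outside `F` would be a coloop of `T`. -/
theorem two_le_card_sdiff_of_mTr_eq_zero {G F T : Finset α} {q : ℕ} (hq : 3 ≤ q) (hG : G ⊆ gr M)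
    (hF : F ∈ flatsQ M (q - 2)) (hT : T ⊆ G) (hrT : M.eRk (T : Set α) = ((q - 1 : ℕ) : ℕ∞))
    (hm : mTr M T = 0) : 2 ≤ (T \ F).card := by
  have hF' := mem_flatsQ.1 hF
  have hTG : T ⊆ gr M := hT.trans hG
  -- a subset of `F` does not have rank `q − 1`
  have hsub : ∀ U : Finset α, U ⊆ F → M.eRk (U : Set α) ≠ ((q - 1 : ℕ) : ℕ∞) := by
    intro U hU hU'
    have h1 : M.eRk (U : Set α) ≤ ((q - 2 : ℕ) : ℕ∞) := by
      rw [← hF'.2.2]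
      exact M.eRk_mono (Finset.coe_subset.2 hU)
    rw [hU'] at h1
    have h2 : q - 1 ≤ q - 2 := by exact_mod_cast h1
    omega
  by_contra hlt
  have h01 : (T \ F).card = 0 ∨ (T \ F).card = 1 := by omega
  rcases h01 with h0 | h1
  · have hTF : T ⊆ F := Finset.sdiff_eq_empty_iff_subset.1 (Finset.card_eq_zero.1 h0)
    exact hsub T hTF hrT
  · obtain ⟨x, hx⟩ := Finset.card_eq_one.1 h1
    have hxT : x ∈ T := (Finset.mem_sdiff.1 (hx ▸ Finset.mem_singleton_self x)).1
    have hsubF : T.erase x ⊆ F := by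
      intro y hy
      rw [Finset.mem_erase] at hy
      by_contra hyF
      have : y ∈ T \ F := Finset.mem_sdiff.2 ⟨hy.2, hyF⟩
      rw [hx, Finset.mem_singleton] at this
      exact hy.1 this
    have hcol : x ∈ coloopsOf M T := by
      rw [mem_coloopsOf_iff_eRk_erase_ne hTG hrT hxT]
      exact hsub _ hsubF
    have : 0 < mTr M T := by
      unfold mTr
      exact Finset.card_pos.2 ⟨x, hcol⟩
    omega

/-- **(GS0c), per trace**: for an `s`-trace `H` of a rank-`(q − 1)` flat containing the rank-`(q − 2)` flat `F`,
and any `F₀ ⊆ F ∩ G`, the coloop-free spanning `j`-subsets of the trace number at most `A₂(s, |F₀|, j)`. -/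
theorem spFm_zero_le_sum_choose {G H F F₀ : Finset α} {q s j : ℕ} (hq : 3 ≤ q) (hG : G ⊆ gr M)
    (hF : F ∈ flatsQ M (q - 2)) (hH : H ∈ flatsTr M G (q - 1) s) (hFH : F ⊆ H) (hF₀ : F₀ ⊆ F ∩ G) :
    spFm M G H (q - 1) j 0 ≤ ∑ i ∈ Finset.Icc 2 j, (s - F₀.card).choose i * F₀.card.choose (j - i) := by
  classical
  have hH' := mem_flatsTr.1 hH
  have hF₀S : F₀ ⊆ H ∩ G := hF₀.trans (Finset.inter_subset_inter hFH (Finset.Subset.refl G))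
  have hF₀F : F₀ ⊆ F := hF₀.trans Finset.inter_subset_left
  rw [← hH'.2.1]
  refine le_trans (Finset.card_le_card ?_) (card_filter_two_le_sdiff_le hF₀S j)
  intro T hT
  rw [Finset.mem_filter, Finset.mem_powersetCard] at hT ⊢
  refine ⟨hT.1, ?_⟩
  have h2 := two_le_card_sdiff_of_mTr_eq_zero hq hG hF (hT.1.1.trans Finset.inter_subset_right) hT.2.1 hT.2.2
  exact h2.trans (Finset.card_le_card (Finset.sdiff_subset_sdiff (Finset.Subset.refl T) hF₀F))

/-- **(GS0c), the class row**: in a pencil (`3s − 2n > B`, `h_s ≥ 2`) whose common flat must have `≥ fh` points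
(`fh ≤ f` for every `f < s` with `h_s·(s − f) ≤ n − f`, the bound of part K), `SPm(s, j, 0) ≤ h_s·A₂(s, fh, j)`. -/
theorem gs0c_row {G : Finset α} {q s B fh : ℕ} (hq : 3 ≤ q) (hB : ∀ a ≤ q - 3, ∀ K ∈ flatsQ M a, K.card ≤ B)
    (hG : G ⊆ gr M) (hlarge : B < 3 * s - 2 * G.card) (hh : 2 ≤ hypTr M G (q - 1) s)
    (hfh : ∀ f < s, hypTr M G (q - 1) s * (s - f) ≤ G.card - f → fh ≤ f) (j : ℕ) :
    spSumM M G (q - 1) s j 0 ≤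
      hypTr M G (q - 1) s * ∑ i ∈ Finset.Icc 2 j, (s - fh).choose i * fh.choose (j - i) := by
  classical
  obtain ⟨F, hF, hFH, hineq⟩ := pencil_card_le (M := M) hq hB hlarge hh
  -- a trace of the pencil exists, and the common flat misses a point of it
  have hpos : 0 < (flatsTr M G (q - 1) s).card := by unfold hypTr at hh; omega
  obtain ⟨H₁, hH₁⟩ := Finset.card_pos.1 hpos
  have hflt : (F ∩ G).card < s :=
    card_inter_lt_of_subset_of_mem_flatsTr (M := M) (by omega) hF hH₁ (hFH H₁ hH₁)
  have hfhf : fh ≤ (F ∩ G).card := hfh _ hflt hineq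
  obtain ⟨F₀, hF₀, hF₀c⟩ := Finset.exists_subset_card_eq hfhf
  unfold spSumM
  calc ∑ H ∈ flatsTr M G (q - 1) s, spFm M G H (q - 1) j 0
      ≤ ∑ H ∈ flatsTr M G (q - 1) s, ∑ i ∈ Finset.Icc 2 j, (s - fh).choose i * fh.choose (j - i) := by
        apply Finset.sum_le_sum
        intro H hH
        rw [← hF₀c]
        exact spFm_zero_le_sum_choose hq hG hF hH (hFH H hH) hF₀
    _ = hypTr M G (q - 1) s * ∑ i ∈ Finset.Icc 2 j, (s - fh).choose i * fh.choose (j - i) := by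
        rw [Finset.sum_const, smul_eq_mul]
        rfl

end PercRepro.Night4
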